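import Summits.QuantumFields.YangMills.Theorems.LuscherReductionTwistedTraceScalingConstTubeOrtho
import Summits.QuantumFields.YangMills.Theorems.LuscherReductionTwistedTraceScalingCovariantCurl
import HarnessLib

/-!
# The POLAR MEAN of the links of a direction: the explicit slow variable of the orthographic tube, with AUTOMATIC balance
# (lane A of S-BASE, crux `TwistedTraceScaling` stmt-QuantumFields-20203, sub-target C4 INNER; design note `pub/ym-fleet/ym-luscher-20007-p1/COARSE-DESIGN.md` §23)

For a configuration `U` of the `L³` torus and a direction `k` let `M_k(U) = Σ_x q(U_{(x,k)}) ∈ ℍ` be the quaternion sum of its links of direction `k`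
(`dirScalarSum` = its real part `Σ_x (U_{(x,k)})₀`, `dirVecSum` = its vector part `Σ_x U⃗_{(x,k)}`), and `p_k(U) = M_k/‖M_k‖ ∈ SU(2)` its POLAR PART
(`polarMean`, via the tree's radial projection `quatToSU2`; `slowMean U` = the one-site configuration `k ↦ p_k(U)`).  Kernel-checked:
* `scalarPart_polarMean`, `vecPart_polarMean`: `p_k = (S_k, V⃗_k)/√(S_k² + |V⃗_k|²)` whenever `(S_k, V⃗_k) ≠ 0`;
* ★★ `sum_vecPart_mul_polarMean_inv`: the relative links `U_{(x,k)} · p_k⁻¹` have BALANCED vector parts, `Σ_x (U_{(x,k)} p_k⁻¹)⃗ = 0` — identically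
  (`Σ_x q(U_x) q(p)⁻¹ = M_k · M̄_k/‖M_k‖ = ‖M_k‖` is real; here via the vector-part product formula: `−S V⃗ + S V⃗ − V⃗ × V⃗ = 0`);
* `sum_scalarPart_mul_polarMean_inv`: `Σ_x (U_{(x,k)} p_k⁻¹)₀ = ‖M_k‖`.
So `slowMean U` is THE candidate slow variable for `mem_orthoTubeSet_of` (`…ConstTubeOrtho`): a configuration lies in the orthographic tube as soon as its
relative links `U_e · p_{dir e}⁻¹` lie in the upper cap — balance is free.  (Coverage of the inner region `{orbitDist < δ}` then follows from a gauge
transformation bringing all links near `1`; separate file.)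
HONEST FRAMING: elementary quaternion algebra for a stub of a child of the CONDITIONAL reduction route R2b1; no kernel estimate; C4 OPEN; not a gap, not Clay.
-/

set_option autoImplicit false

noncomputable section

open MeasureTheory Filter Topology Real
open scoped BigOperators Matrix Quaternion
open Literature.MathematicalPhysics.QuantumFieldTheory
open Literature.MathematicalPhysics.QuantumLattice

namespace Summit.QuantumFields.YangMills.Theorems.FemtoTransferGap.TwoLattice.ConstTube

open Summit.QuantumFields.YangMills.Theorems.FemtoTransferGap
open Summit.QuantumFields.YangMills.Theorems.FemtoTransferGap.TwoLattice.Cov (scalarPart_inv vecPart_inv)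

variable (L : ℕ) [NeZero L]

/-! ## §1 The quaternion sum of a direction and its polar part -/

/-- The scalar sum of direction `k`: `S_k(U) = Σ_x (U_{(x,k)})₀`. [folklore] -/
def dirScalarSum (k : Fin 3) (U : GaugeConfig 3 L SU2) : ℝ := ∑ x : Site 3 L, scalarPart (U (x, k))

/-- The vector sum of direction `k`: `V⃗_k(U) = Σ_x U⃗_{(x,k)}`. [folklore] -/
def dirVecSum (k : Fin 3) (U : GaugeConfig 3 L SU2) : Fin 3 → ℝ := ∑ x : Site 3 L, vecPart (U (x, k))

/-- The quaternion sum of direction `k` assembled from its parts: `M_k = (S_k, V⃗_k)`. [folklore] -/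
def dirQuat (k : Fin 3) (U : GaugeConfig 3 L SU2) : ℍ := ⟨dirScalarSum L k U, dirVecSum L k U 0, dirVecSum L k U 1, dirVecSum L k U 2⟩

/-- **The polar mean** of direction `k`: the radial projection of the quaternion sum to `SU(2)` (junk `1` if the sum vanishes). [folklore] -/
def polarMean (k : Fin 3) (U : GaugeConfig 3 L SU2) : SU2 := quatToSU2 (dirQuat L k U)

/-- **The slow one-site configuration** of `U`: direction `k` ↦ polar mean of direction `k`. [folklore] -/
def slowMean (U : GaugeConfig 3 L SU2) : GaugeConfig 3 1 SU2 := fun e => polarMean L e.2 U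

/-- Links of the slow mean. [folklore] -/
@[simp] theorem slowMean_apply (U : GaugeConfig 3 L SU2) (e : Edge 3 1) : slowMean L U e = polarMean L e.2 U := rfl

/-- The squared norm of the quaternion sum: `‖M_k‖² = S_k² + |V⃗_k|²`. [folklore] -/
theorem normSq_dirQuat (k : Fin 3) (U : GaugeConfig 3 L SU2) :
    Quaternion.normSq (dirQuat L k U) = dirScalarSum L k U ^ 2 + ∑ a, dirVecSum L k U a ^ 2 := by
  rw [Quaternion.normSq_def', Fin.sum_univ_three]
  simp only [dirQuat]
  ring

/-- `‖M_k‖ = √(S_k² + |V⃗_k|²)`. [folklore] -/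
theorem norm_dirQuat (k : Fin 3) (U : GaugeConfig 3 L SU2) : ‖dirQuat L k U‖ = √(dirScalarSum L k U ^ 2 + ∑ a, dirVecSum L k U a ^ 2) := by
  rw [← normSq_dirQuat, Quaternion.normSq_eq_norm_mul_self, Real.sqrt_mul_self (norm_nonneg _)]

/-- The quaternion sum vanishes iff both parts vanish. [folklore] -/
theorem dirQuat_ne_zero_iff (k : Fin 3) (U : GaugeConfig 3 L SU2) :
    dirQuat L k U ≠ 0 ↔ 0 < dirScalarSum L k U ^ 2 + ∑ a, dirVecSum L k U a ^ 2 := by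
  rw [← normSq_dirQuat, ← Quaternion.normSq_ne_zero]
  constructor
  · intro h; exact lt_of_le_of_ne (Quaternion.normSq_nonneg) (Ne.symm h)
  · intro h; exact h.ne'

/-- A positive scalar sum makes the quaternion sum non-zero. [folklore] -/
theorem dirQuat_ne_zero_of_scalarSum_pos {k : Fin 3} {U : GaugeConfig 3 L SU2} (h : 0 < dirScalarSum L k U) : dirQuat L k U ≠ 0 := by
  rw [dirQuat_ne_zero_iff]
  have : 0 ≤ ∑ a, dirVecSum L k U a ^ 2 := Finset.sum_nonneg fun a _ => sq_nonneg _
  nlinarith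

/-- ★ **Parts of the polar mean**: `(p_k)₀ = S_k/‖M_k‖` and `p⃗_k = V⃗_k/‖M_k‖` (for `M_k ≠ 0`). [folklore] -/
theorem parts_polarMean {k : Fin 3} {U : GaugeConfig 3 L SU2} (h : dirQuat L k U ≠ 0) :
    scalarPart (polarMean L k U) = ‖dirQuat L k U‖⁻¹ * dirScalarSum L k U ∧
      vecPart (polarMean L k U) = ‖dirQuat L k U‖⁻¹ • dirVecSum L k U := by
  have hc := coe_quatToSU2 h
  have e0 : vecPart (polarMean L k U) 0 = ‖dirQuat L k U‖⁻¹ * dirVecSum L k U 0 := by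
    rw [vecPart_zero, polarMean, hc]; simp [dirQuat]
  have e1 : vecPart (polarMean L k U) 1 = ‖dirQuat L k U‖⁻¹ * dirVecSum L k U 1 := by
    rw [vecPart_one, polarMean, hc]; simp [dirQuat]
  have e2 : vecPart (polarMean L k U) 2 = ‖dirQuat L k U‖⁻¹ * dirVecSum L k U 2 := by
    rw [vecPart_two, polarMean, hc]; simp [dirQuat]
  refine ⟨?_, ?_⟩
  · rw [scalarPart_eq, polarMean, hc]
    simp [dirQuat]
  · funext a
    fin_cases a
    · simpa using e0
    · simpa using e1
    · simpa using e2

/-- `(p_k)₀ = S_k/‖M_k‖`. [folklore] -/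
theorem scalarPart_polarMean {k : Fin 3} {U : GaugeConfig 3 L SU2} (h : dirQuat L k U ≠ 0) :
    scalarPart (polarMean L k U) = ‖dirQuat L k U‖⁻¹ * dirScalarSum L k U := (parts_polarMean L h).1

/-- `p⃗_k = V⃗_k/‖M_k‖`. [folklore] -/
theorem vecPart_polarMean {k : Fin 3} {U : GaugeConfig 3 L SU2} (h : dirQuat L k U ≠ 0) :
    vecPart (polarMean L k U) = ‖dirQuat L k U‖⁻¹ • dirVecSum L k U := (parts_polarMean L h).2

/-! ## §2 ★★ Automatic balance of the relative links -/

/-- Vector part of a relative link `A B⁻¹`: `(AB⁻¹)⃗ = −A₀ B⃗ + B₀ A⃗ − A⃗ × B⃗`. [cite: BrockerTomDieck1985, I (1.10)] -/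
theorem vecPart_mul_inv (A B : SU2) : vecPart (A * B⁻¹) = -(scalarPart A • vecPart B) + scalarPart B • vecPart A - vecPart A ⨯₃ vecPart B := by
  rw [vecPart_mul, scalarPart_inv, vecPart_inv, smul_neg, LinearMap.map_neg]
  abel

/-- Scalar part of a relative link `A B⁻¹`: `(AB⁻¹)₀ = A₀B₀ + A⃗·B⃗`. [cite: BrockerTomDieck1985, I (1.10)] -/
theorem scalarPart_mul_inv (A B : SU2) : scalarPart (A * B⁻¹) = scalarPart A * scalarPart B + vecPart A ⬝ᵥ vecPart B := by
  rw [scalarPart_mul, scalarPart_inv, vecPart_inv, dotProduct_neg, sub_neg_eq_add]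

/-- ★★ **AUTOMATIC BALANCE**: the relative links `U_{(x,k)} · p_k⁻¹` against the polar mean have balanced vector parts, `Σ_x (U_{(x,k)} p_k⁻¹)⃗ = 0`
(for `M_k ≠ 0`; `−S V⃗ + S V⃗ − V⃗ × V⃗ = 0` after scaling by `‖M_k‖⁻¹`). [folklore] -/
theorem sum_vecPart_mul_polarMean_inv {k : Fin 3} {U : GaugeConfig 3 L SU2} (h : dirQuat L k U ≠ 0) :
    ∑ x : Site 3 L, vecPart (U (x, k) * (polarMean L k U)⁻¹) = 0 := by
  obtain ⟨hs, hv⟩ := parts_polarMean L h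
  set r := ‖dirQuat L k U‖⁻¹ with hr
  have hcross : ∑ x : Site 3 L, vecPart (U (x, k)) ⨯₃ vecPart (polarMean L k U) = dirVecSum L k U ⨯₃ vecPart (polarMean L k U) := by
    rw [dirVecSum, map_sum, LinearMap.sum_apply]
  calc ∑ x : Site 3 L, vecPart (U (x, k) * (polarMean L k U)⁻¹)
      = ∑ x : Site 3 L, (-(scalarPart (U (x, k)) • vecPart (polarMean L k U)) + scalarPart (polarMean L k U) • vecPart (U (x, k))
          - vecPart (U (x, k)) ⨯₃ vecPart (polarMean L k U)) := Finset.sum_congr rfl fun x _ => vecPart_mul_inv _ _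
    _ = -(dirScalarSum L k U • vecPart (polarMean L k U)) + scalarPart (polarMean L k U) • dirVecSum L k U
          - dirVecSum L k U ⨯₃ vecPart (polarMean L k U) := by
        rw [Finset.sum_sub_distrib, Finset.sum_add_distrib, Finset.sum_neg_distrib, ← Finset.sum_smul, ← Finset.smul_sum, hcross]
        rfl
    _ = 0 := by
        rw [hs, hv, LinearMap.map_smul, cross_self, smul_zero, sub_zero, smul_smul]
        ext a
        simp only [Pi.add_apply, Pi.neg_apply, Pi.smul_apply, smul_eq_mul, Pi.zero_apply]
        ring

/-- Componentwise form of the automatic balance (the hypothesis `hbal` of `mem_orthoTubeSet_of`). [folklore] -/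
theorem sum_vecPart_mul_polarMean_inv_apply {k : Fin 3} {U : GaugeConfig 3 L SU2} (h : dirQuat L k U ≠ 0) (a : Fin 3) :
    ∑ x : Site 3 L, vecPart (U (x, k) * (polarMean L k U)⁻¹) a = 0 := by
  have := congrFun (sum_vecPart_mul_polarMean_inv L h) a
  rwa [Finset.sum_apply] at this

/-- ★ **The scalar sum of the relative links is the norm of the quaternion sum**: `Σ_x (U_{(x,k)} p_k⁻¹)₀ = ‖M_k‖`. [folklore] -/
theorem sum_scalarPart_mul_polarMean_inv {k : Fin 3} {U : GaugeConfig 3 L SU2} (h : dirQuat L k U ≠ 0) :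
    ∑ x : Site 3 L, scalarPart (U (x, k) * (polarMean L k U)⁻¹) = ‖dirQuat L k U‖ := by
  obtain ⟨hs, hv⟩ := parts_polarMean L h
  have hn0 : ‖dirQuat L k U‖ ≠ 0 := norm_ne_zero_iff.mpr h
  have hn : ‖dirQuat L k U‖ ^ 2 = dirScalarSum L k U ^ 2 + ∑ a, dirVecSum L k U a ^ 2 := by
    rw [← normSq_dirQuat, Quaternion.normSq_eq_norm_mul_self, sq]
  calc ∑ x : Site 3 L, scalarPart (U (x, k) * (polarMean L k U)⁻¹)
      = ∑ x : Site 3 L, (scalarPart (U (x, k)) * scalarPart (polarMean L k U) + vecPart (U (x, k)) ⬝ᵥ vecPart (polarMean L k U)) :=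
        Finset.sum_congr rfl fun x _ => scalarPart_mul_inv _ _
    _ = dirScalarSum L k U * scalarPart (polarMean L k U) + dirVecSum L k U ⬝ᵥ vecPart (polarMean L k U) := by
        rw [Finset.sum_add_distrib, ← Finset.sum_mul, dirVecSum, sum_dotProduct]; rfl
    _ = ‖dirQuat L k U‖⁻¹ * (dirScalarSum L k U ^ 2 + ∑ a, dirVecSum L k U a ^ 2) := by
        rw [hs, hv, dotProduct_smul, smul_eq_mul]
        simp only [dotProduct, sq]
        ring
    _ = ‖dirQuat L k U‖ := by
        rw [← hn]; field_simp

end Summit.QuantumFields.YangMills.Theorems.FemtoTransferGap.TwoLattice.ConstTube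

end
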